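import Summits.BirchSwinnertonDyer.BirchSwinnertonDyer.Theorems.ThetaPartnerAtTwoMazurTateCongruenceAtTwoTopOfManinConstant
import HarnessLib

/-!
# Crux `MazurTateCongruenceAtTwoTop` (stmt-BirchSwinnertonDyer-25797 = `MazurTateCongruenceAtTwoR` 21416 BY NAME), line `symbol` v8:
# K1 BY NAME from binders the route's `closes` ALREADY HAS — the Hecke bundle's conjuncts SD, Bz and the period binder `hPer2` (item 24944) —
# and from the three single-fact alias items 27800 (SD) · 27798 (Bz) · 24944 (period fact at 2)
# (lead seat bsd-wall-tp2-p1 g13; `--supports stmt-BirchSwinnertonDyer-25797`; THEOREMS ONLY — no `def`, no `sorry`; BSD is not proved)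

STATE OF RECORD BEFORE THIS FILE. The K1 floor in the tree is PUB³ {SD, Bz, AU}
(`MazurTateCongruenceAtTwoR.mazurTateCongruenceAtTwoTop_of_sdBzAu`, `…TopOfManinConstant`, tp2-p1-w2 g5), with AU entering ONLY through the
period fact at `2`, `realPeriodRat_eq_unit_mul_plusPeriod_two` (`…_of_sdBz_periodTwo (hSD) (hBz) (h2)`). That period fact is ITSELF a binder
of the route's `closes`: `(hPer2 : RealPeriodPlusPeriodUnitAtTwoSupply)` (item stmt-BirchSwinnertonDyer-24944, the Literature fact BY NAME,
held for the twin K2r0P). THIS FILE records the consequence as by-name closers whose hypotheses are route declarations only: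
* §1 `mazurTateCongruenceAtTwoTop_of_pub_per2 (hPUB : PublishedInputsHeckeAtTwo) (hPer2 : RealPeriodPlusPeriodUnitAtTwoSupply)` — closes recipe
  `hMTt := … hPUB hPer2`; of the five conjuncts ES ∧ SD ∧ Bz ∧ Se ∧ AU of item 27435 exactly SD (`.2.1`) and Bz (`.2.2.1`) are used;
* §2 `mazurTateCongruenceAtTwoTop_of_aliasInputs (hSD : HeckeSelfDualTorsionJ0Input) (hBz : BuzzardMultiplicityOneGammaZeroInput)
  (hPer2 : RealPeriodPlusPeriodUnitAtTwoSupply)` — K1 from the three SINGLE-FACT alias items 27800 · 27798 · 24944 (no bundle);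
* the `MazurTateCongruenceAtTwoR` (item 21416) twins of both.
So K1's print debt RELATIVE to the closes' other binders is PUB² {Hecke self-duality of `J₀(N)[ℓ]` (Darmon–Diamond–Taylor 1995, Lemma 1.38),
Buzzard 2000 Prop. 2.4}; the road's absolute floor stays PUB³ (AU ⟹ 24944 by
`SkinnerUrban2014.realPeriodRat_eq_unit_mul_plusPeriod_two_fact_of_abbesUllmo`).

HONEST FRAMING: every theorem is CONDITIONAL on the displayed named facts (held, cite-level published theorems); nothing here closes an
item (a by-name closer lives in a module importing the route file, so `closes` cannot consume it); BSD is not proved by any of this.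

References: Greenberg–Vatsal, Invent. Math. 142 (2000) Thm. (1.4), §3 (13) [GreenbergVatsal2000]; Vatsal, Duke 98 (1999) Thm. (1.10)
[Vatsal1999]; Buzzard, MRL 7 (2000) Prop. 2.4 [Buzzard2000LevelLoweringModTwo]; Darmon–Diamond–Taylor (1995) §1.6 Lemma 1.38, §4.5
[DarmonDiamondTaylor1995]; Abbes–Ullmo, Compositio 103 (1996) Thm. A [AbbesUllmo1996]; Edixhoven (1991) Prop. 2 [EdixhovenManin1991].
-/

-- justification: the `Summit.BirchSwinnertonDyer.BirchSwinnertonDyer.…` path repeats a component (route-file convention)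
set_option linter.dupNamespace false
set_option autoImplicit false

noncomputable section

namespace Summit.BirchSwinnertonDyer.BirchSwinnertonDyer.Theorems.MazurTateCongruenceAtTwoR

open Summit.BirchSwinnertonDyer.BirchSwinnertonDyer.Theses.ThetaPartnerAtTwo

/-! ## §1 K1 from the closes' binders `hPUB` (27435: conjuncts SD, Bz) and `hPer2` (24944) -/

/-- **`MazurTateCongruenceAtTwoTop` BY NAME from two binders the route's `closes` already has**: the Hecke bundle
`PublishedInputsHeckeAtTwo` (item 27435; only its conjuncts SD = `.2.1` and Bz = `.2.2.1` are used — ES, Se and AU are idle) and the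
period binder `RealPeriodPlusPeriodUnitAtTwoSupply` (item 24944 = `realPeriodRat_eq_unit_mul_plusPeriod_two` BY NAME). Closes recipe:
`hMTt := MazurTateCongruenceAtTwoR.mazurTateCongruenceAtTwoTop_of_pub_per2 hPUB hPer2`. Proof = tp2-p1-w2 g5's
`mazurTateCongruenceAtTwoTop_of_sdBz_periodTwo`. BSD is not proved by this. [cite: GreenbergVatsal2000, Thm. (1.4) and §3 (13)]
[cite: Buzzard2000LevelLoweringModTwo, Prop. 2.4] [cite: DarmonDiamondTaylor1995, §1.6 Lemma 1.38 and §4.5] -/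
theorem mazurTateCongruenceAtTwoTop_of_pub_per2 (hPUB : PublishedInputsHeckeAtTwo)
    (hPer2 : RealPeriodPlusPeriodUnitAtTwoSupply) : MazurTateCongruenceAtTwoTop :=
  mazurTateCongruenceAtTwoTop_of_sdBz_periodTwo hPUB.2.1 hPUB.2.2.1 hPer2

/-- The twin `MazurTateCongruenceAtTwoR` (item 21416) BY NAME from the same two binders. [cite: GreenbergVatsal2000, §3 (13)] -/
theorem mazurTateCongruenceAtTwoR_of_pub_per2 (hPUB : PublishedInputsHeckeAtTwo)
    (hPer2 : RealPeriodPlusPeriodUnitAtTwoSupply) : MazurTateCongruenceAtTwoR :=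
  mazurTateCongruenceAtTwoTop_of_pub_per2 hPUB hPer2

/-! ## §2 K1 from the three single-fact alias items 27800 (SD) · 27798 (Bz) · 24944 (period fact at `2`) -/

/-- **`MazurTateCongruenceAtTwoTop` BY NAME from the route's three SINGLE-FACT alias items** `HeckeSelfDualTorsionJ0Input` (27800 = Hecke
self-duality of `J₀(N)[ℓ]`, Darmon–Diamond–Taylor Lemma 1.38), `BuzzardMultiplicityOneGammaZeroInput` (27798 = Buzzard 2000 Prop. 2.4) and
`RealPeriodPlusPeriodUnitAtTwoSupply` (24944 = `Ω(W) = u·Ω⁺_f`, `|u|₂ = 1`): no bundle, no Eichler–Shimura, no Serre 1972, no Abbes–Ullmo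
hypothesis (the last reaches the route only through 24944). BSD is not proved by this. [cite: Vatsal1999, Thm. (1.10)]
[cite: GreenbergVatsal2000, §3 (13)] [cite: Buzzard2000LevelLoweringModTwo, Prop. 2.4] [cite: DarmonDiamondTaylor1995, §1.6 Lemma 1.38] -/
theorem mazurTateCongruenceAtTwoTop_of_aliasInputs (hSD : HeckeSelfDualTorsionJ0Input)
    (hBz : BuzzardMultiplicityOneGammaZeroInput) (hPer2 : RealPeriodPlusPeriodUnitAtTwoSupply) :
    MazurTateCongruenceAtTwoTop :=
  mazurTateCongruenceAtTwoTop_of_sdBz_periodTwo hSD hBz hPer2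

/-- The twin `MazurTateCongruenceAtTwoR` (item 21416) BY NAME from the three single-fact alias items 27800 · 27798 · 24944.
[cite: GreenbergVatsal2000, §3 (13)] -/
theorem mazurTateCongruenceAtTwoR_of_aliasInputs (hSD : HeckeSelfDualTorsionJ0Input)
    (hBz : BuzzardMultiplicityOneGammaZeroInput) (hPer2 : RealPeriodPlusPeriodUnitAtTwoSupply) :
    MazurTateCongruenceAtTwoR :=
  mazurTateCongruenceAtTwoTop_of_aliasInputs hSD hBz hPer2

end Summit.BirchSwinnertonDyer.BirchSwinnertonDyer.Theorems.MazurTateCongruenceAtTwoR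

end
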